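import Literature.Probability.RandomPlanarGeometry.HexSAWStripBetaCoefficientLaw
import HarnessLib

/-!
# The two renewal ends of a long critical β-walk decouple: first and last renewal levels are asymptotically independent
# (module «BETA-ENDS-DECOUPLE»)

Topic `Literature/Probability/RandomPlanarGeometry` (continues «BETA-COEFF» `HexSAWStripBetaCoefficientLaw.lean` — the limit pieces
`HV.headCoeff`, `HV.hb0Coeff`, `HV.tailCoeff`, their series `HV.headGF`, `HV.tailGF` at `y_T`, the renewal sum `HV.betaRenewalSum` and its
limit `HV.tendsto_betaRenewalSum_mul_pow`; «BETA-SPLIT» `HexSAWStripBetaRenewalSplit.lean` — the box counts `HV.renACoeff T L (a, b, i, j, k)`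
of the case-A β-walks of `S_{T,L}` by the levels `a, b` of their FIRST and LAST renewal vertex and the contacts `i, j, k` of head,
middle bridge and tail, with the type-by-type sandwich `HV.prod_le_renACoeff` / `HV.renACoeff_le_prod`).  Lane «pcv-sawmu»
(CriticalPhenomena venture), a-p2 g21.  Sources of the SETTING: H. Duminil-Copin, A. Hammond, CMP 324 (2013) §2.2 (renewal points);
N. R. Beaton, M. Bousquet-Mélou, J. de Gier, H. Duminil-Copin, A. J. Guttmann, CMP 326 (2014) §3.2, Corollary 8 (arXiv:1109.0358v5
p. 12: `y_T`); H. Duminil-Copin, S. Smirnov, Ann. Math. 175 (2012) §3.  Nothing of the kind is printed.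

## What is proved (namespace `Literature.Probability.RandomPlanarGeometry.SAW.HV`; `y_T = stripYT T`, `T ≥ 2`; `BRS_{ab}(m)` denotes the
pair term `Σ_{i+j+k=m} f_a(i) d⁰_{ab}(j) g_b(k)` of `betaRenewalSum T m`, written out in the statements)

* §1 ★★ `tendsto_pairRenewalSum_mul_pow` — `BRS_{ab}(m) · y_T^m ⟶ F_a · (R_{ab}/y_T) · G_b` for any positive residue data `R` of the
  bridge kernel (the per-pair form of «BETA-COEFF» §8).
* §2 `renACoeff_sum_T3_bounds`, ★★ `tendsto_renACoeff_sum_T3` — the box counts converge: `Σ_{i+j+k=m} a_L(a,b,i,j,k) ⟶ BRS_{ab}(m)` as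
  `L → ∞`; so `BRS_{ab}(m)` IS the `x_c`-weighted number of case-A β-walks of the infinite strip with a renewal index, first renewal
  vertex on level `a`, last renewal vertex on level `b`, and `m` surface contacts.
* §3 ★★★ `exists_tendsto_pairRenewalSum_div` — DECOUPLING: with the `u`, `ℓ`, `ρ` of the bridge residue theorem,
  `BRS_{ab}(m) / BRS(m) ⟶ (F_a u_a / Σ_c F_c u_c) · (ℓ_b G_b / Σ_c ℓ_c G_c)`: conditionally on `m` surface contacts, the levels of the
  first and of the last renewal vertex of a critical β-walk are asymptotically INDEPENDENT as `m → ∞`, with explicit marginal laws;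
  ★★ `exists_tendsto_pairRenewalSum_div_stripBcoeff` — the same product law for `2 · BRS_{ab}(m) / β_{T,m}` (relative to ALL β-walks:
  the mirror class counted twice, the walks without renewal index negligible by «BETA-NORENEWAL»).

Label: LANE THEOREM (own result of lane «pcv-sawmu», a-p2 g21, 2026-08-26); the β-walk analogue of the bridges' entrance/exit decoupling
`HV.exists_tendsto_hbCoeff_ratio`.  NOT claimed: a rate, uniformity in `T`, `T = 1`, joint laws involving the contact numbers of the pieces.
-/

noncomputable section

open Finset Filter Topology Literature.Probability.LatticeModels Literature.Probability.Percolation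

namespace Literature.Probability.RandomPlanarGeometry.SAW

namespace HV

variable {T : ℕ}

/-! ### §1 The renewal sum of ONE pair of levels converges at the threshold -/

/-- ★★ **Per-pair convergence**: for residue data `R` of the bridge kernel (`(y_T − y) D_{ab}(y) → R_{ab} > 0`; the residue theorem
gives `R_{ab} = ρ u_a ℓ_b`), for every pair of levels `(a, b)`:
`Σ_{i+j+k=m} f_a(i) d⁰_{ab}(j) g_b(k) · y_T^m ⟶ F_a · (R_{ab}/y_T) · G_b` (two dominated convolutions; the per-pair form of
«BETA-COEFF»'s `tendsto_betaRenewalSum_mul_pow`). [cite: MadrasSlade1993, Appendix B, proof of Theorem B.1; Feller1968, XIII.11; DuminilCopinHammond2013, §2.2; lane «pcv-sawmu» a-p2 g21 — own] -/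
theorem tendsto_pairRenewalSum_mul_pow (hT : 2 ≤ T) {R : Fin (2 * T) → Fin (2 * T) → ℝ} (hR : ∀ a b, 0 < R a b)
    (hD : ∀ a b, Tendsto (fun y => (stripYT T - y) * hKernel T a b y) (𝓝[<] stripYT T) (𝓝 (R a b))) (a b : Fin (2 * T)) :
    Tendsto (fun m => (∑ p ∈ antidiagonal m, ∑ q ∈ antidiagonal p.2,
        headCoeff T p.1 a * hb0Coeff T q.1 a b * tailCoeff T q.2 b) * stripYT T ^ m) atTop
      (𝓝 (headGF T a * ((R a b / stripYT T) * tailGF T b))) := by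
  have hT1 : 1 ≤ T := by omega
  have hyT := one_lt_stripYT hT1
  have hy0 : 0 ≤ stripYT T := by linarith
  -- distribute the powers
  have heq : ∀ m, (∑ p ∈ antidiagonal m, ∑ q ∈ antidiagonal p.2,
      headCoeff T p.1 a * hb0Coeff T q.1 a b * tailCoeff T q.2 b) * stripYT T ^ m =
      ∑ p ∈ antidiagonal m, (headCoeff T p.1 a * stripYT T ^ p.1) *
        ∑ q ∈ antidiagonal p.2, (hb0Coeff T q.1 a b * stripYT T ^ q.1) * (tailCoeff T q.2 b * stripYT T ^ q.2) := by
    intro m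
    rw [sum_mul]
    refine sum_congr rfl fun p hp => ?_
    rw [sum_mul, mul_sum]
    refine sum_congr rfl fun q hq => ?_
    have hpm : p.1 + p.2 = m := mem_antidiagonal.1 hp
    have hq' : q.1 + q.2 = p.2 := mem_antidiagonal.1 hq
    rw [← hpm, ← hq', pow_add, pow_add]
    ring
  simp_rw [heq]
  set α : ℕ → ℝ := fun i => headCoeff T i a * stripYT T ^ i with hα
  set β : ℕ → ℝ := fun k => tailCoeff T k b * stripYT T ^ k with hβ
  set δ : ℕ → ℝ := fun j => hb0Coeff T j a b * stripYT T ^ j with hδ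
  have hα0 : ∀ i, 0 ≤ α i := fun i => mul_nonneg (headCoeffN_le_tendsto hT i _).2.1 (pow_nonneg hy0 _)
  have hβ0 : ∀ k, 0 ≤ β k := fun k => mul_nonneg (tailCoeffN_le_tendsto hT k _).2.1 (pow_nonneg hy0 _)
  have hδ0 : ∀ j, 0 ≤ δ j := fun j => mul_nonneg (hb0CoeffN_le_tendsto hT1 j a b).2.1 (pow_nonneg hy0 _)
  have hαs : Summable α := (summable_headCoeff_mul_pow hT _).1
  have hβs : Summable β := (summable_tailCoeff_mul_pow hT _).1
  have hd : Tendsto (fun j => hbCoeff T j a b * stripYT T ^ j) atTop (𝓝 (R a b / stripYT T)) :=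
    tendsto_hbCoeff_mul_pow_of_residue hT hR hD a b
  have hδlim : Tendsto δ atTop (𝓝 (R a b / stripYT T)) := by
    refine hd.congr' ?_
    filter_upwards [eventually_ge_atTop 1] with j hj
    simp only [hδ]
    rw [hb0Coeff_eq_hbCoeff hj]
  obtain ⟨B, hB⟩ := hd.bddAbove_range
  have hB' : ∀ j, hbCoeff T j a b * stripYT T ^ j ≤ B := fun j => hB ⟨j, rfl⟩
  set K : ℝ := ((stripChains T 0).card : ℝ) with hK
  have hδB : ∀ j, |δ j| ≤ B + K := by
    intro j
    rw [abs_of_nonneg (hδ0 j)]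
    simp only [hδ]
    rcases Nat.eq_zero_or_pos j with rfl | hj
    · have h0 := hB' 0
      have := hb0Coeff_le_hbCoeff_add hT1 0 a b
      rw [pow_zero, mul_one] at h0 ⊢
      linarith
    · rw [hb0Coeff_eq_hbCoeff hj]
      linarith [hB' j, hK ▸ (Nat.cast_nonneg _ : (0 : ℝ) ≤ ((stripChains T 0).card : ℝ))]
  have hBK : 0 ≤ B + K := (abs_nonneg _).trans (hδB 0)
  set U : ℕ → ℝ := fun n => ∑ q ∈ antidiagonal n, δ q.1 * β q.2 with hU
  have hUswap : ∀ n, U n = ∑ q ∈ antidiagonal n, β q.1 * δ q.2 := by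
    intro n
    simp only [hU]
    rw [← Finset.Nat.sum_antidiagonal_swap]
    exact sum_congr rfl fun q _ => by simp only [Prod.fst_swap, Prod.snd_swap]; ring
  have hUlim : Tendsto U atTop (𝓝 ((∑' k, β k) * (R a b / stripYT T))) :=
    (Literature.Probability.Process.Renewal.tendsto_sum_antidiagonal_mul hβ0 hβs hδB hδlim).congr
      fun n => (hUswap n).symm
  have hU0 : ∀ n, 0 ≤ U n := fun n => sum_nonneg fun q _ => mul_nonneg (hδ0 _) (hβ0 _)
  have hUB : ∀ n, |U n| ≤ (B + K) * ∑' k, β k := by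
    intro n
    rw [abs_of_nonneg (hU0 n), hUswap n]
    calc ∑ q ∈ antidiagonal n, β q.1 * δ q.2 ≤ ∑ q ∈ antidiagonal n, β q.1 * (B + K) :=
          sum_le_sum fun q _ => mul_le_mul_of_nonneg_left ((le_abs_self _).trans (hδB _)) (hβ0 _)
      _ = (B + K) * ∑ q ∈ antidiagonal n, β q.1 := by rw [← sum_mul, mul_comm]
      _ ≤ (B + K) * ∑' k, β k := by
          refine mul_le_mul_of_nonneg_left ?_ hBK
          rw [Finset.Nat.sum_antidiagonal_eq_sum_range_succ_mk]
          exact hβs.sum_le_tsum (range (n + 1)) fun k _ => hβ0 k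
  have hlim := Literature.Probability.Process.Renewal.tendsto_sum_antidiagonal_mul hα0 hαs hUB hUlim
  have hval : (∑' i, α i) * ((∑' k, β k) * (R a b / stripYT T)) = headGF T a * ((R a b / stripYT T) * tailGF T b) := by
    simp only [hα, hβ, headGF, tailGF]; ring
  rw [← hval]
  refine hlim.congr fun m => ?_
  simp only [hU, hα, hβ, hδ]

/-! ### §2 The box counts of renewal walks by the levels of their first and last renewal vertex -/

section Box

variable {L N : ℕ}

/-- The box count of the case-A β-walks of `S_{T,L}` with a renewal index, first renewal vertex on level `a`, last on level `b`,
and `m` surface contacts, summed over the three contact numbers (plumbing around «BETA-SPLIT»'s `renACoeff`): it lies between the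
truncated renewal sums with truncations `(N, N, N)`, `3N ≤ L`, and `(|V|, |V|, |V|)`.
[cite: DuminilCopinHammond2013, §2.2; lane «pcv-sawmu» a-p2 g20/g21] -/
theorem renACoeff_sum_T3_bounds (hT : 1 ≤ T) (a b : Fin (2 * T)) (m : ℕ) :
    (∀ N L, 3 * N ≤ L → ∑ p ∈ antidiagonal m, ∑ q ∈ antidiagonal p.2,
        headCoeffN T N p.1 a * hb0CoeffN T N q.1 a b * tailCoeffN T N q.2 b ≤
      ∑ t ∈ T3 m, renACoeff T L (((a : ℕ) : ℤ), ((b : ℕ) : ℤ), t.1, t.2.1, t.2.2)) ∧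
    (∀ N L, (stripV T L).card ≤ N + 1 → ∑ t ∈ T3 m, renACoeff T L (((a : ℕ) : ℤ), ((b : ℕ) : ℤ), t.1, t.2.1, t.2.2) ≤
      ∑ p ∈ antidiagonal m, ∑ q ∈ antidiagonal p.2,
        headCoeffN T N p.1 a * hb0CoeffN T N q.1 a b * tailCoeffN T N q.2 b) := by
  constructor
  · intro N L hL
    rw [sum_T3 m (fun t => renACoeff T L (((a : ℕ) : ℤ), ((b : ℕ) : ℤ), t.1, t.2.1, t.2.2))]
    exact sum_le_sum fun p _ => sum_le_sum fun q _ => prod_le_renACoeff hT (N := N) (N' := N) (by omega) _ _ _ _ _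
  · intro N L hN
    rw [sum_T3 m (fun t => renACoeff T L (((a : ℕ) : ℤ), ((b : ℕ) : ℤ), t.1, t.2.1, t.2.2))]
    exact sum_le_sum fun p _ => sum_le_sum fun q _ => renACoeff_le_prod hT hN _ _ _ _ _

/-- ★★ **The box counts converge to the renewal sum of the pair**: as `L → ∞`,
`Σ_{i+j+k=m} a_L(a, b, i, j, k) ⟶ Σ_{i+j+k=m} f_a(i) d⁰_{ab}(j) g_b(k)` (every `T ≥ 2`, all levels `a, b`, all `m`).
[cite: DuminilCopinHammond2013, §2.2; DuminilCopinSmirnov2012, §3 (S_{T,L} ↑ S_T); lane «pcv-sawmu» a-p2 g21 — own] -/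
theorem tendsto_renACoeff_sum_T3 (hT : 2 ≤ T) (a b : Fin (2 * T)) (m : ℕ) :
    Tendsto (fun L => ∑ t ∈ T3 m, renACoeff T L (((a : ℕ) : ℤ), ((b : ℕ) : ℤ), t.1, t.2.1, t.2.2)) atTop
      (𝓝 (∑ p ∈ antidiagonal m, ∑ q ∈ antidiagonal p.2, headCoeff T p.1 a * hb0Coeff T q.1 a b * tailCoeff T q.2 b)) := by
  have hT1 : 1 ≤ T := by omega
  obtain ⟨hlow, hup⟩ := renACoeff_sum_T3_bounds hT1 a b m
  -- the truncated sums as a function of the truncation converge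
  have hS : Tendsto (fun N => ∑ p ∈ antidiagonal m, ∑ q ∈ antidiagonal p.2,
      headCoeffN T N p.1 a * hb0CoeffN T N q.1 a b * tailCoeffN T N q.2 b) atTop
      (𝓝 (∑ p ∈ antidiagonal m, ∑ q ∈ antidiagonal p.2, headCoeff T p.1 a * hb0Coeff T q.1 a b * tailCoeff T q.2 b)) := by
    refine tendsto_finsetSum _ fun p _ => tendsto_finsetSum _ fun q _ => ?_
    exact (((headCoeffN_le_tendsto hT p.1 _).2.2.mul (hb0CoeffN_le_tendsto hT1 q.1 a b).2.2)).mul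
      (tailCoeffN_le_tendsto hT q.2 _).2.2
  -- lower sequence: truncation `L / 3 → ∞`; upper sequence: truncation `|V(S_{T,L})| → ∞`
  have h3 : Tendsto (fun L : ℕ => L / 3) atTop atTop :=
    tendsto_atTop_atTop.2 fun N => ⟨3 * N, fun L hL => by omega⟩
  have hV : Tendsto (fun L : ℕ => (stripV T L).card) atTop atTop := by
    refine tendsto_atTop_mono (fun L => ?_) tendsto_id
    -- `|V(S_{T,L})| ≥ L`: the bottom row `(x, 0, ↑)`, `0 ≤ x ≤ L − 1`… use the vertices `(x, 0, false)`, `x ∈ [0, L)`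
    have hsub : (Finset.range L).image (fun x : ℕ => (((x : ℤ), (0 : ℤ), false) : HV)) ⊆ stripV T L := by
      intro v hv
      rw [mem_image] at hv
      obtain ⟨x, hx, rfl⟩ := hv
      rw [mem_range] at hx
      rw [mem_stripV_iff]
      simp [bit]
      omega
    have hcard := card_le_card hsub
    rw [card_image_of_injective _ (fun x x' h => by simpa using h), card_range] at hcard
    simpa using hcard
  refine tendsto_of_tendsto_of_tendsto_of_le_of_le (hS.comp h3) (hS.comp hV) (fun L => ?_) (fun L => ?_)
  · exact hlow (L / 3) L (by omega)
  · exact hup _ L (Nat.le_succ _)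

end Box

/-! ### §3 ★★★ The first and the last renewal level of a long critical β-walk DECOUPLE -/

/-- ★★★ **THE TWO RENEWAL ENDS DECOUPLE** (`T ≥ 2`).  With the `u`, `ℓ`, `ρ` of the bridge residue theorem and the head / tail
series `F`, `G` of «BETA-COEFF»: for every pair of levels `(a, b)`, the renewal sum of the pair over the whole renewal sum converges,
`BRS_{ab}(m) / BRS(m) ⟶ (F_a u_a / Σ_c F_c u_c) · (ℓ_b G_b / Σ_c ℓ_c G_c)`,
a PRODUCT law: among the critical β-walks of the strip with `m` surface contacts and a renewal index, the level of the FIRST renewal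
vertex and the level of the LAST renewal vertex are asymptotically independent as `m → ∞`, with the explicit marginals
`F_a u_a / Σ F u` and `ℓ_b G_b / Σ ℓ G` (by `tendsto_renACoeff_sum_T3`, `BRS_{ab}(m) = lim_L Σ_{i+j+k=m} a_L(a,b,i,j,k)` IS the infinite-strip
count of these walks).  Renewal structure ⇒ independence of the two ends, as for the bridges' entrance/exit levels
(`exists_tendsto_hbCoeff_ratio`). [cite: DuminilCopinHammond2013, §2.2 (renewal decomposition); Feller1968, XIII.11; MadrasSlade1993, Theorem 4.2.2 (b); lane «pcv-sawmu» a-p2 g21 — own result] -/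
theorem exists_tendsto_pairRenewalSum_div (hT : 2 ≤ T) :
    ∃ (u ℓ : Fin (2 * T) → ℝ) (ρ : ℝ), (∀ a, 0 < u a) ∧ (∀ b, 0 < ℓ b) ∧ 0 < ρ ∧
      (∀ a b, Tendsto (fun m : ℕ => hbCoeff T m a b * stripYT T ^ m) atTop (𝓝 (ρ * (u a * ℓ b) / stripYT T))) ∧
      0 < ∑ c : Fin (2 * T), headGF T c * u c ∧ 0 < ∑ c : Fin (2 * T), ℓ c * tailGF T c ∧
      ∀ a b : Fin (2 * T), Tendsto (fun m : ℕ =>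
        (∑ p ∈ antidiagonal m, ∑ q ∈ antidiagonal p.2, headCoeff T p.1 a * hb0Coeff T q.1 a b * tailCoeff T q.2 b) /
          betaRenewalSum T m) atTop
        (𝓝 ((headGF T a * u a / ∑ c : Fin (2 * T), headGF T c * u c) *
          (ℓ b * tailGF T b / ∑ c : Fin (2 * T), ℓ c * tailGF T c))) := by
  have hT1 : 1 ≤ T := by omega
  have hyT := one_lt_stripYT hT1
  have hy : 0 < stripYT T := by linarith
  obtain ⟨-, u, ℓ, ρ, -, hu, hℓ, -, -, hρ, hres⟩ := exists_tendsto_hKernel_residue hT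
  have hR : ∀ a b, 0 < ρ * (u a * ℓ b) := fun a b => mul_pos hρ (mul_pos (hu a) (hℓ b))
  -- positivity of the two marginal normalisations
  have hF : 0 < ∑ c : Fin (2 * T), headGF T c * u c := by
    have hmem : (⟨1, by omega⟩ : Fin (2 * T)) ∈ (univ : Finset (Fin (2 * T))) := mem_univ _
    refine lt_of_lt_of_le ?_ (single_le_sum (f := fun c : Fin (2 * T) => headGF T c * u c)
      (fun c _ => mul_nonneg (headGF_tailGF_nonneg hT _ 0).1 (hu c).le) hmem)
    exact mul_pos (by simpa using headGF_one_pos hT) (hu _)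
  have hG : 0 < ∑ c : Fin (2 * T), ℓ c * tailGF T c := by
    have hmem : (⟨2 * T - 2, by omega⟩ : Fin (2 * T)) ∈ (univ : Finset (Fin (2 * T))) := mem_univ _
    refine lt_of_lt_of_le ?_ (single_le_sum (f := fun c : Fin (2 * T) => ℓ c * tailGF T c)
      (fun c _ => mul_nonneg (hℓ c).le (headGF_tailGF_nonneg hT 0 _).2) hmem)
    refine mul_pos (hℓ _) ?_
    have hcast : (((⟨2 * T - 2, by omega⟩ : Fin (2 * T)) : ℕ) : ℤ) = 2 * (T : ℤ) - 2 := by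
      push_cast [Nat.cast_sub (show 2 ≤ 2 * T by omega)]; ring
    rw [hcast]
    exact tailGF_top_pos hT
  refine ⟨u, ℓ, ρ, hu, hℓ, hρ, fun a b => tendsto_hbCoeff_mul_pow_of_residue hT hR hres a b, hF, hG, fun a b => ?_⟩
  -- numerator and denominator, both rescaled by `y_T^m`
  have hnum := tendsto_pairRenewalSum_mul_pow hT hR hres a b
  have hden := tendsto_betaRenewalSum_mul_pow hT hR hres
  set Λ := ∑ a : Fin (2 * T), ∑ b : Fin (2 * T), headGF T a * ((ρ * (u a * ℓ b) / stripYT T) * tailGF T b) with hΛ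
  have hΛeq : Λ = ρ / stripYT T * ((∑ c : Fin (2 * T), headGF T c * u c) * (∑ c : Fin (2 * T), ℓ c * tailGF T c)) := by
    rw [hΛ, sum_mul_sum, mul_sum]
    refine sum_congr rfl fun a _ => ?_
    rw [mul_sum]
    refine sum_congr rfl fun b _ => ?_
    ring
  have hΛ0 : 0 < Λ := by rw [hΛeq]; positivity
  have hdiv := hnum.div hden hΛ0.ne'
  have hval : headGF T a * ((ρ * (u a * ℓ b) / stripYT T) * tailGF T b) / Λ =
      (headGF T a * u a / ∑ c : Fin (2 * T), headGF T c * u c) * (ℓ b * tailGF T b / ∑ c : Fin (2 * T), ℓ c * tailGF T c) := by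
    rw [hΛeq]
    field_simp
  rw [hval] at hdiv
  refine hdiv.congr fun m => ?_
  simp only [Pi.div_apply]
  rw [mul_div_mul_right _ _ (pow_ne_zero _ hy.ne')]

/-- ★★ **Relative to ALL critical β-walks**: the same product law for
`2 · BRS_{ab}(m) / β_{T,m}` — the fraction (counting both mirror classes) of the β-walks with `m` surface contacts whose renewal split has
first level `a` and last level `b`; the walks without renewal index are negligible (`n(m) y_T^m → 0`). [cite: DuminilCopinHammond2013, §2.2; DuminilCopinSmirnov2012, §3 (the mirror symmetry of S_T); lane «pcv-sawmu» a-p2 g21 — own result] -/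
theorem exists_tendsto_pairRenewalSum_div_stripBcoeff (hT : 2 ≤ T) :
    ∃ (u ℓ : Fin (2 * T) → ℝ), (∀ a, 0 < u a) ∧ (∀ b, 0 < ℓ b) ∧
      0 < ∑ c : Fin (2 * T), headGF T c * u c ∧ 0 < ∑ c : Fin (2 * T), ℓ c * tailGF T c ∧
      ∀ a b : Fin (2 * T), Tendsto (fun m : ℕ =>
        2 * (∑ p ∈ antidiagonal m, ∑ q ∈ antidiagonal p.2, headCoeff T p.1 a * hb0Coeff T q.1 a b * tailCoeff T q.2 b) /
          stripBcoeff T m) atTop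
        (𝓝 ((headGF T a * u a / ∑ c : Fin (2 * T), headGF T c * u c) *
          (ℓ b * tailGF T b / ∑ c : Fin (2 * T), ℓ c * tailGF T c))) := by
  have hT1 : 1 ≤ T := by omega
  have hyT := one_lt_stripYT hT1
  have hy : 0 < stripYT T := by linarith
  obtain ⟨-, u, ℓ, ρ, -, hu, hℓ, -, -, hρ, hres⟩ := exists_tendsto_hKernel_residue hT
  have hR : ∀ a b, 0 < ρ * (u a * ℓ b) := fun a b => mul_pos hρ (mul_pos (hu a) (hℓ b))
  obtain ⟨u', ℓ', ρ', hu', hℓ', hρ', hbr, hB⟩ := exists_tendsto_stripBcoeff_mul_pow hT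
  -- identify the β-limit with THESE residue data: both equal the limit of `2 · BRS(m) y_T^m + o(1)`
  have hden' : Tendsto (fun m : ℕ => stripBcoeff T m * stripYT T ^ m) atTop
      (𝓝 (2 * ∑ a : Fin (2 * T), ∑ b : Fin (2 * T), headGF T a * ((ρ * (u a * ℓ b) / stripYT T) * tailGF T b))) := by
    have hconv := tendsto_betaRenewalSum_mul_pow hT hR hres
    have hlow : Tendsto (fun m => 2 * (betaRenewalSum T m * stripYT T ^ m)) atTop _ := hconv.const_mul 2
    have hup : Tendsto (fun m => 2 * (betaRenewalSum T m * stripYT T ^ m) + 2 * (noRenCoeff T m * stripYT T ^ m)) atTop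
        (𝓝 (2 * ∑ a : Fin (2 * T), ∑ b : Fin (2 * T), headGF T a * ((ρ * (u a * ℓ b) / stripYT T) * tailGF T b))) := by
      have := hlow.add ((summable_noRenCoeff_mul_pow hT).2.const_mul 2)
      simpa using this
    refine tendsto_of_tendsto_of_tendsto_of_le_of_le hlow hup (fun m => ?_) (fun m => ?_)
    · have h := mul_le_mul_of_nonneg_right (two_mul_betaRenewalSum_le_stripBcoeff hT m) (pow_nonneg hy.le m)
      linarith
    · have h := mul_le_mul_of_nonneg_right (stripBcoeff_le_two_mul hT m) (pow_nonneg hy.le m)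
      linarith
  have hF : 0 < ∑ c : Fin (2 * T), headGF T c * u c := by
    have hmem : (⟨1, by omega⟩ : Fin (2 * T)) ∈ (univ : Finset (Fin (2 * T))) := mem_univ _
    refine lt_of_lt_of_le ?_ (single_le_sum (f := fun c : Fin (2 * T) => headGF T c * u c)
      (fun c _ => mul_nonneg (headGF_tailGF_nonneg hT _ 0).1 (hu c).le) hmem)
    exact mul_pos (by simpa using headGF_one_pos hT) (hu _)
  have hG : 0 < ∑ c : Fin (2 * T), ℓ c * tailGF T c := by
    have hmem : (⟨2 * T - 2, by omega⟩ : Fin (2 * T)) ∈ (univ : Finset (Fin (2 * T))) := mem_univ _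
    refine lt_of_lt_of_le ?_ (single_le_sum (f := fun c : Fin (2 * T) => ℓ c * tailGF T c)
      (fun c _ => mul_nonneg (hℓ c).le (headGF_tailGF_nonneg hT 0 _).2) hmem)
    refine mul_pos (hℓ _) ?_
    have hcast : (((⟨2 * T - 2, by omega⟩ : Fin (2 * T)) : ℕ) : ℤ) = 2 * (T : ℤ) - 2 := by
      push_cast [Nat.cast_sub (show 2 ≤ 2 * T by omega)]; ring
    rw [hcast]
    exact tailGF_top_pos hT
  refine ⟨u, ℓ, hu, hℓ, hF, hG, fun a b => ?_⟩
  have hnum := (tendsto_pairRenewalSum_mul_pow hT hR hres a b).const_mul 2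
  set Λ := ∑ a : Fin (2 * T), ∑ b : Fin (2 * T), headGF T a * ((ρ * (u a * ℓ b) / stripYT T) * tailGF T b) with hΛ
  have hΛeq : Λ = ρ / stripYT T * ((∑ c : Fin (2 * T), headGF T c * u c) * (∑ c : Fin (2 * T), ℓ c * tailGF T c)) := by
    rw [hΛ, sum_mul_sum, mul_sum]
    refine sum_congr rfl fun a _ => ?_
    rw [mul_sum]
    refine sum_congr rfl fun b _ => ?_
    ring
  have hΛ0 : 0 < 2 * Λ := by rw [hΛeq]; positivity
  have hdiv := hnum.div hden' hΛ0.ne'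
  have hval : 2 * (headGF T a * ((ρ * (u a * ℓ b) / stripYT T) * tailGF T b)) / (2 * Λ) =
      (headGF T a * u a / ∑ c : Fin (2 * T), headGF T c * u c) * (ℓ b * tailGF T b / ∑ c : Fin (2 * T), ℓ c * tailGF T c) := by
    rw [hΛeq]
    field_simp
  rw [hval] at hdiv
  refine hdiv.congr fun m => ?_
  simp only [Pi.div_apply]
  rw [← mul_assoc, mul_div_mul_right _ _ (pow_ne_zero _ hy.ne')]

end HV

end Literature.Probability.RandomPlanarGeometry.SAW
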